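import Literature.NumberTheory.Transcendental.ZeroEstMain
import Literature.NumberTheory.Transcendental.ZeroEstStdBridge
import Literature.NumberTheory.Transcendental.ThetaSubgroupHull
import Literature.NumberTheory.Transcendental.PkappaThetaCosetHilbert
import Literature.NumberTheory.Transcendental.PkappaAnalyticGroupModel
import HarnessLib

/-!
# The `Θ`-closed irreducible subgroups of `Lie M_κ` with at most one elliptic factor

Topic `Literature/NumberTheory/Transcendental`. The CLASSIFICATION of the obstruction subgroups of
Philippon's zero estimate (D. Roy, LNM 1752 Ch. 11 Thm. 4.1: a closed irreducible subgroup `H₀`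
of `V = Lie G` for the Zariski topology of `G` pulled back to `V`; in the tree
`AnalyticGroupModel.zero_estimate`, `ZeroEstMain.lean`) for the theta model of the groups
`M_κ = 𝔾ₘ^β × P_κ` (`PkappaTheta.lean`) with AT MOST ONE elliptic factor, complex multiplication
allowed: such an `H₀` is `exp⁻¹(G')` for the connected algebraic subgroup `G'` with datum
`K = hullData (𝒯(H₀))` (`ThetaSubgroupHull.lean`; `𝒯` = lineality space `linSpace`), i.e.
`H₀ = Lie G' + ker(exp)` (`GaGmE.Std.preimageSubgroup`) and `Lie G' = 𝒯(H₀)`.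

We work with an arbitrary analytic group model `M` on `V = ℂ^β × ℂ^γ × ℂ^δ` whose projective
coordinates ARE the theta functions `Θ_J` of `PkappaTheta.lean` up to an indexing equivalence
`e` (hypothesis `hΘ`; the instance is built in the discharge of `philippon1986_std`), so that
`M.F P = F_{P ∘ e⁻¹}` (`GaGmE.Std.thetaEval`). The proof (no use of `End(E)`):

* Step A (`tangent_hull_linSpace_eq`, `preimageSubgroup_hull_le`): by the hull theorem a form
  vanishing on `𝔥 = 𝒯(H₀) ⊆ H₀` vanishes on `Lie(hull 𝔥)`, so `Lie(hull 𝔥) ⊆ H₀` (closedness), a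
  subspace of the subgroup `H₀`, hence `⊆ 𝒯(H₀)`: `Lie(hull 𝔥) = 𝔥`; `ker ⊆ H₀` by automorphy.
* Step B0 (`coneDim_le_finrank_linSpace_succ`, any model): `dim H₀ ≤ dim 𝒯(H₀)` — Roy's
  transversal family at `σ = 0` for a complement of `𝒯(H₀)` (`exists_transversal`) and the count
  `binom(T+s,s) H_𝔭(t) ≤ H_𝔊(t + c'T)` (`choose_mul_hilbC_le` with `𝔮 = 𝔊`), read for `t = T → ∞`.
* Step B1 (`choose_le_hilbC_vanishing_tangent`, `finrank_tangent_succ_le_coneDim`):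
  `H(𝔍(Lie G'); t) ≥ binom(t + dim G' + 1, dim G' + 1)` from the coset lower bound of
  `PkappaThetaCosetHilbert.lean` in every degree `d ≤ t` (the cone variable separates degrees),
  so `coneDim (Lie G') ≥ dim G' + 1` (`𝔍` of a subspace is prime: identity theorem).
* Step B2: `Y = Z(𝔍(𝔥))` is closed, `0 ∈ Y ⊆ H₀`, `coneDim Y ≥ dim 𝔥 + 1 ≥ coneDim H₀`, so
  `Y = H₀` (irreducibility).
* Step B3 (`mem_preimageSubgroup_hull_of_forall_thetaEval`, pure theta functions): `Z(𝔍(𝔥)) ⊆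
  𝔥 + ker` by explicit forms — `σ(z')³` (`X_{(none,(0,none))}`), the binomials of the integer
  characters of `A = yRel 𝔥` (saturation lemma), and the linear forms
  `∑_e ξ_e X_{(none,(M, some e))}`, `ξ ∈ sRel 𝔥` (`P₂(0) = -2 ≠ 0`, `Z₂(0) = 0`).

Finally (`zeroEstimate_of_thetaModel`, `zeroEstimate_oneFactor_of_hardData`): Philippon's zero estimate
(1986, Thm. 2.1) in the shape of the named fact `philippon1986_std` at `(L, β, γ, δ, κ)` WITHOUT
its hypothesis `¬ L.HasCM`, for `|γ| ≤ 1` — for any theta model, in particular for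
`GaGmE.Std.thetaModel L κM H` built from the hard geometric data `H : GaGmE.Std.HardData L κM` of
the theta embedding (`PkappaAnalyticGroupModel.lean`); and the classification hypothesis `hCL` of
`GaGmE.Std.philippon_shape_of_classification` for `|γ| ≤ 1` (`classification_oneFactor_of_hardData`).
With the hard data supplied, `zeroEstimate_oneFactor_of_hardData` is the hypothesis `hZ` of
`ellipticPeriod_not_mem_logSpan_of_zeroEstimate_oneFactor` (`EllipticPeriodLogSpanProofs.lean`):
the whole transcendence input of `ellipticPeriod_not_mem_logSpan` (Huber–Wüstholz 2022,
Thm. 15.3 (1)), with or without complex multiplication.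

Everything is PROVED; the only definitions are the explicit forms `binomForm`, `linForm`; no
named facts.

## References

* Yu. V. Nesterenko, P. Philippon (eds.), *Introduction to Algebraic Independence Theory*,
  LNM 1752, Springer 2001, Ch. 11 (D. Roy), Thm. 4.1, Prop. 3.8. [NesterenkoPhilippon2001]
* P. Philippon, *Lemmes de zéros dans les groupes algébriques commutatifs*, Bull. Soc. Math.
  France 114 (1986), 355–383, Thm. 2.1. [Philippon1986]
* D. Bertrand, P. Philippon, *Sous-groupes algébriques de groupes algébriques commutatifs*,
  Illinois J. Math. 32 (1988), 263–280. [folklore]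
* A. Huber, G. Wüstholz, *Transcendence and Linear Relations of 1-Periods*, CUP 2022, Thm. 15.3.
  [HuberWustholz2022]
-/

noncomputable section

open Complex MvPolynomial Set Module
open scoped PeriodPair Pointwise

namespace Literature.NumberTheory.Transcendental

/-! ## Complements on analytic group models -/

namespace AnalyticGroupModel


variable {V : Type*} [NormedAddCommGroup V] [NormedSpace ℂ V] {N : ℕ} (M : AnalyticGroupModel V N)

attribute [local instance] MvPolynomial.gradedAlgebra

omit M in
/-- A subspace contained in an additive subgroup lies in its lineality space. [folklore] -/
theorem le_linSpace_of_subset {𝔩 : Submodule ℂ V} {H : AddSubgroup V} (h : (𝔩 : Set V) ⊆ H) :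
    𝔩 ≤ linSpace (H : Set V) := by
  intro x hx v hv t
  exact H.add_mem hv (h (𝔩.smul_mem t hx))

omit M in
/-- The lineality space of an additive subgroup is contained in it. [folklore] -/
theorem linSpace_subset (H : AddSubgroup V) : (linSpace (H : Set V) : Set V) ⊆ H := by
  intro x hx
  have := hx 0 H.zero_mem 1
  simpa using this

/-- **`𝔍` of a subspace is prime** (the cone over a subspace is the analytic image of the
connected space `ℂ × 𝔩`, on which analytic functions have no zero divisors). [folklore] -/
theorem isPrime_vanishing_submodule (𝔩 : Submodule ℂ V) : (M.vanishing (𝔩 : Set V)).IsPrime := by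
  refine ⟨M.vanishing_ne_top ⟨0, 𝔩.zero_mem⟩, fun {P Q} hPQ => ?_⟩
  have hιan : AnalyticOnNhd ℂ (fun p : ℂ × 𝔩 => ((p.1, (p.2 : V)) : ℂ × V)) univ :=
    ((ContinuousLinearMap.id ℂ ℂ).prodMap 𝔩.subtypeL).analyticOnNhd univ
  have hf : ∀ R : MvPolynomial (Fin (N + 1)) ℂ,
      AnalyticOnNhd ℂ ((fun p : ℂ × V => eval (p.1 • M.pt p.2) R) ∘
        (fun p : ℂ × 𝔩 => ((p.1, (p.2 : V)) : ℂ × V))) univ := fun R =>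
    (M.analyticOnNhd_eval_cone R).comp hιan (mapsTo_univ _ _)
  have h := eq_zero_or_eq_zero_of_mul_eq_zero (hf P) (hf Q) fun p => by
    show eval (p.1 • M.pt (p.2 : V)) P * eval (p.1 • M.pt (p.2 : V)) Q = 0
    rw [← map_mul]
    exact hPQ _ p.2.2 _
  rcases h with h | h
  · refine Or.inl fun w hw c => ?_
    have := h (c, ⟨w, hw⟩)
    exact this
  · refine Or.inr fun w hw c => ?_
    have := h (c, ⟨w, hw⟩)
    exact this

/-- Words in derivations send `0` into any ideal. [folklore] -/
theorem opPow_zero_mem {R : Type*} [CommRing R] [Algebra ℂ R] {s : ℕ} (d : Fin s → Derivation ℂ R R)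
    (μ : Fin s → ℕ) (I : Ideal R) : MultiplicityLemma.opPow d μ 0 ∈ I := by
  have h := MultiplicityLemma.opPow_mem_pow_sub d I μ (N := MultiplicityLemma.order μ + 1) (f := 0)
    (Submodule.zero_mem _)
  rwa [Nat.add_sub_cancel_left, pow_one] at h

section DimBound

variable [CompleteSpace V] [FiniteDimensional ℂ V]

omit [CompleteSpace V] in
/-- **The count at the origin for `𝔮 = 𝔊`**: for a relevant homogeneous prime `𝔭 ⊇ 𝔊` whose zero
set contains `0` and is stable under addition, `binom(T+s, s) · H_𝔭(t) ≤ H_𝔊(t + c'T)` for all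
`T, t`, with `s = dim V - dim 𝒯(Z(𝔭))` (Roy's transversal family at `σ = 0`, and Step 1 of
Prop. 3.8 is void for `𝔮 = 𝔊`). [cite: NesterenkoPhilippon2001, Ch. 11 Prop. 3.8 (95)] -/
theorem choose_mul_hilbC_le_hilbC_relIdeal {𝔭 : Ideal (MvPolynomial (Fin (N + 1)) ℂ)} (h𝔭 : 𝔭.IsPrime)
    (hhom : 𝔭.IsHomogeneous (homogeneousSubmodule (Fin (N + 1)) ℂ)) (h𝔊 : M.relIdeal ≤ 𝔭) (hrel : M.IsRelevant 𝔭)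
    (h0 : (0 : V) ∈ M.zeroSet ((𝔭 : Ideal _) : Set (MvPolynomial (Fin (N + 1)) ℂ)))
    (hstab : ∀ w ∈ M.zeroSet ((𝔭 : Ideal _) : Set (MvPolynomial (Fin (N + 1)) ℂ)),
      ∀ v ∈ M.zeroSet ((𝔭 : Ideal _) : Set (MvPolynomial (Fin (N + 1)) ℂ)),
        v + w ∈ M.zeroSet ((𝔭 : Ideal _) : Set (MvPolynomial (Fin (N + 1)) ℂ))) :
    ∃ c' : ℕ, ∀ T t,
      (T + (finrank ℂ (⊤ : Submodule ℂ V) - finrank ℂ ↥((⊤ : Submodule ℂ V) ⊓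
          linSpace (M.zeroSet ((𝔭 : Ideal _) : Set (MvPolynomial (Fin (N + 1)) ℂ)))))).choose
        (finrank ℂ (⊤ : Submodule ℂ V) - finrank ℂ ↥((⊤ : Submodule ℂ V) ⊓
          linSpace (M.zeroSet ((𝔭 : Ideal _) : Set (MvPolynomial (Fin (N + 1)) ℂ))))) *
        ZeroEst.hilbC (𝔭.restrictScalars ℂ) t ≤
      ZeroEst.hilbC (N := N) (M.relIdeal.restrictScalars ℂ) (t + c' * T) := by
  classical
  haveI := h𝔭
  obtain ⟨J₀, hΘσ⟩ := M.exists_Θ_ne_zero (0 : V)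
  have hstab' : ∀ w ∈ M.zeroSet ((𝔭 : Ideal _) : Set (MvPolynomial (Fin (N + 1)) ℂ)),
      ∀ v ∈ M.zeroSet ((𝔭 : Ideal _) : Set (MvPolynomial (Fin (N + 1)) ℂ)),
        v + (w - 0) ∈ M.zeroSet ((𝔭 : Ideal _) : Set (MvPolynomial (Fin (N + 1)) ℂ)) := by
    intro w hw v hv
    rw [sub_zero]
    exact hstab w hw v hv
  set Lsp := linSpace (M.zeroSet ((𝔭 : Ideal _) : Set (MvPolynomial (Fin (N + 1)) ℂ))) with hLsp
  set s := finrank ℂ (⊤ : Submodule ℂ V) - finrank ℂ ↥((⊤ : Submodule ℂ V) ⊓ Lsp) with hs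
  obtain ⟨x, hxli, -, hxtr⟩ := exists_complement_basis (⊤ : Submodule ℂ V) Lsp
  obtain ⟨G, hG𝔭, hoff, hdiag⟩ := M.exists_transversal hhom h𝔊 hrel h0 hΘσ hstab' hxli hxtr
  set d : Fin s → Derivation ℂ M.Quot M.Quot := fun i => M.quotDer J₀ (x i) with hd
  have hcomm : ∀ i j (a : M.Quot), d i (d j a) = d j (d i a) := fun i j a => M.quotDer_comm hΘσ (x i) (x j) a
  have hmem𝔭 : ∀ {y : MvPolynomial (Fin (N + 1)) ℂ},
      Ideal.Quotient.mk M.relIdeal y ∈ 𝔭.map (Ideal.Quotient.mk M.relIdeal) ↔ y ∈ 𝔭 := by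
    intro y
    rw [← Ideal.mem_comap, Ideal.comap_map_of_surjective _ Ideal.Quotient.mk_surjective,
      ← RingHom.ker_eq_comap_bot, Ideal.mk_ker, sup_eq_left.mpr h𝔊]
  have hoff' : ∀ i j, i ≠ j → d i (Ideal.Quotient.mk M.relIdeal (G j)) ∈ 𝔭.map (Ideal.Quotient.mk M.relIdeal) := by
    intro i j hij
    change M.quotDer J₀ (x i) (Ideal.Quotient.mk M.relIdeal (G j)) ∈ _
    rw [quotDer_mk]
    exact hmem𝔭.mpr (hoff i j hij)
  have hdiag' : ∀ i, d i (Ideal.Quotient.mk M.relIdeal (G i)) ∉ 𝔭.map (Ideal.Quotient.mk M.relIdeal) := by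
    intro i hmem
    change M.quotDer J₀ (x i) (Ideal.Quotient.mk M.relIdeal (G i)) ∈ _ at hmem
    rw [quotDer_mk] at hmem
    exact hdiag i (hmem𝔭.mp hmem)
  set c' := Finset.univ.sup fun i => (G i).totalDegree with hc'
  have hGdeg : ∀ i, G i ∈ ZeroEst.Fil (N := N) c' := fun i =>
    ZeroEst.mem_Fil.mpr (Finset.le_sup (f := fun i => (G i).totalDegree) (Finset.mem_univ i))
  refine ⟨c', fun T t => ?_⟩
  have H𝔮 : ∀ Q ∈ M.relIdeal, ∀ μ : Fin s → ℕ, MultiplicityLemma.order μ ≤ T →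
      MultiplicityLemma.opPow d μ (Ideal.Quotient.mk M.relIdeal Q) ∈ 𝔭.map (Ideal.Quotient.mk M.relIdeal) := by
    intro Q hQ μ _
    rw [Ideal.Quotient.eq_zero_iff_mem.mpr hQ]
    exact opPow_zero_mem d μ _
  exact M.choose_mul_hilbC_le h𝔭 h𝔊 hcomm hG𝔭 hGdeg hoff' hdiag' H𝔮 t

omit [CompleteSpace V] in
/-- **Comparison of growth exponents, product form**: if
`binom(t+s, s) · ρ₁ binom(t - a₁ + d₁, d₁) ≤ ρ₂ binom(c t + γ₂ + d₂, d₂)` for all large `t`, with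
`ρ₁ ≥ 1`, then `s + d₁ ≤ d₂`. [folklore] -/
theorem add_le_of_choose_mul_choose_le {s d₁ d₂ ρ₁ ρ₂ a₁ γ₂ c t₀ : ℕ} (hρ₁ : 1 ≤ ρ₁)
    (h : ∀ t, t₀ ≤ t → (t + s).choose s * (ρ₁ * (t - a₁ + d₁).choose d₁) ≤
      ρ₂ * (c * t + γ₂ + d₂).choose d₂) : s + d₁ ≤ d₂ := by
  by_contra hlt
  push Not at hlt
  set L := c + c * a₁ + γ₂ + d₂ + 1 with hL
  set B := s.factorial * d₁.factorial * ρ₂ * L ^ d₂ with hB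
  set t := B + a₁ + t₀ with ht
  set n := t - a₁ with hn
  have h1 := h t (by omega)
  -- lower bounds
  have h2 : (n + 1) ^ d₁ ≤ d₁.factorial * (ρ₁ * (n + d₁).choose d₁) := by
    calc (n + 1) ^ d₁ ≤ d₁.factorial * (n + d₁).choose d₁ := GaGm.pow_succ_le_factorial_mul_choose n d₁
      _ ≤ d₁.factorial * (ρ₁ * (n + d₁).choose d₁) := Nat.mul_le_mul_left _ (Nat.le_mul_of_pos_left _ hρ₁)
  have h2' : (n + 1) ^ s ≤ s.factorial * (t + s).choose s := by
    calc (n + 1) ^ s ≤ s.factorial * (n + s).choose s := GaGm.pow_succ_le_factorial_mul_choose n s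
      _ ≤ s.factorial * (t + s).choose s :=
          Nat.mul_le_mul_left _ (Nat.choose_le_choose s (by omega))
  -- upper bound
  have htn : t = n + a₁ := by omega
  have hlin : c * t + γ₂ + d₂ ≤ L * (n + 1) := by
    have hX : c ≤ L := by rw [hL]; omega
    calc c * t + γ₂ + d₂ = c * n + (c * a₁ + γ₂ + d₂) := by rw [htn]; ring
      _ ≤ L * n + L := add_le_add (Nat.mul_le_mul_right _ hX) (by rw [hL]; omega)
      _ = L * (n + 1) := by ring
  have h3 : (c * t + γ₂ + d₂).choose d₂ ≤ (L * (n + 1)) ^ d₂ := by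
    calc (c * t + γ₂ + d₂).choose d₂ ≤ (c * t + γ₂ + d₂) ^ d₂ := Nat.choose_le_pow _ _
      _ ≤ (L * (n + 1)) ^ d₂ := Nat.pow_le_pow_left hlin _
  have h4 : (n + 1) ^ (s + d₁) ≤ B * (n + 1) ^ d₂ := by
    calc (n + 1) ^ (s + d₁) = (n + 1) ^ s * (n + 1) ^ d₁ := pow_add _ _ _
      _ ≤ (s.factorial * (t + s).choose s) * (d₁.factorial * (ρ₁ * (n + d₁).choose d₁)) :=
          Nat.mul_le_mul h2' h2
      _ = (s.factorial * d₁.factorial) * ((t + s).choose s * (ρ₁ * (n + d₁).choose d₁)) := by ring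
      _ ≤ (s.factorial * d₁.factorial) * (ρ₂ * (c * t + γ₂ + d₂).choose d₂) := Nat.mul_le_mul_left _ h1
      _ ≤ (s.factorial * d₁.factorial) * (ρ₂ * (L * (n + 1)) ^ d₂) :=
          Nat.mul_le_mul_left _ (Nat.mul_le_mul_left _ h3)
      _ = B * (n + 1) ^ d₂ := by rw [hB, mul_pow]; ring
  have h5 : (n + 1) ^ d₂ * (n + 1) ≤ (n + 1) ^ (s + d₁) := by
    rw [← pow_succ]
    exact Nat.pow_le_pow_right (Nat.succ_pos n) hlt
  have h6 : (n + 1) ^ d₂ * (n + 1) ≤ (n + 1) ^ d₂ * B := by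
    calc (n + 1) ^ d₂ * (n + 1) ≤ (n + 1) ^ (s + d₁) := h5
      _ ≤ B * (n + 1) ^ d₂ := h4
      _ = (n + 1) ^ d₂ * B := mul_comm _ _
  have h7 : n + 1 ≤ B := Nat.le_of_mul_le_mul_left h6 (pow_pos (Nat.succ_pos n) _)
  omega

/-- **`dim H₀ ≤ dim 𝒯(H₀)` for a closed irreducible subgroup `H₀`** (`coneDim = dim + 1`, `𝒯` the
lineality space): Roy's transversal family at `σ = 0` for a complement of `𝒯(H₀)` and the count
`binom(T+s, s) · H_𝔭(T) ≤ H_𝔊((1 + c')T)`, compared with the Hilbert sandwiches of `𝔭 = 𝔍(H₀)`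
and `𝔊`. [cite: NesterenkoPhilippon2001, Ch. 11 Prop. 3.8 (95)] -/
theorem coneDim_le_finrank_linSpace_succ (H : AddSubgroup V) (hH : M.IsIrred (H : Set V)) :
    M.coneDim (H : Set V) ≤ finrank ℂ (linSpace (H : Set V)) + 1 := by
  classical
  have hhom : (M.vanishing (H : Set V)).IsHomogeneous (homogeneousSubmodule (Fin (N + 1)) ℂ) :=
    M.isHomogeneous_vanishing _
  have h𝔊 : M.relIdeal ≤ M.vanishing (H : Set V) := M.relIdeal_le_vanishing _
  have hrel : M.IsRelevant (M.vanishing (H : Set V)) := M.isRelevant_vanishing ⟨0, H.zero_mem⟩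
  have hZ : M.zeroSet ((M.vanishing (H : Set V) : Ideal _) : Set (MvPolynomial (Fin (N + 1)) ℂ)) = (H : Set V) :=
    hH.isClosedG.eq
  have h0 : (0 : V) ∈ M.zeroSet ((M.vanishing (H : Set V) : Ideal _) : Set (MvPolynomial (Fin (N + 1)) ℂ)) := by
    rw [hZ]; exact H.zero_mem
  have hstab : ∀ w ∈ M.zeroSet ((M.vanishing (H : Set V) : Ideal _) : Set (MvPolynomial (Fin (N + 1)) ℂ)),
      ∀ v ∈ M.zeroSet ((M.vanishing (H : Set V) : Ideal _) : Set (MvPolynomial (Fin (N + 1)) ℂ)),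
        v + w ∈ M.zeroSet ((M.vanishing (H : Set V) : Ideal _) : Set (MvPolynomial (Fin (N + 1)) ℂ)) := by
    intro w hw v hv
    rw [hZ] at hw hv ⊢
    exact H.add_mem hv hw
  obtain ⟨c', hc'⟩ := M.choose_mul_hilbC_le_hilbC_relIdeal hH.isPrime hhom h𝔊 hrel h0 hstab
  rw [hZ, top_inf_eq, finrank_top, M.finrank_eq] at hc'
  have hle : finrank ℂ (linSpace (H : Set V)) ≤ M.dim := by
    rw [← M.finrank_eq]; exact Submodule.finrank_le _
  set m := finrank ℂ (linSpace (H : Set V)) with hm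
  set s := M.dim - m with hs
  -- the sandwiches
  set d₁ := M.coneDim (H : Set V) with hd₁
  haveI := hH.isPrime
  have hdim₁ : ringKrullDim (MvPolynomial (Fin (N + 1)) ℂ ⧸ M.vanishing (H : Set V)) = d₁ :=
    (M.coneDim_eq ⟨0, H.zero_mem⟩).symm
  obtain ⟨ρ₁, a₁, γ₁, hρ₁, hs₁⟩ := ZeroEst.exists_sandwich_of_isPrime (𝔭 := M.vanishing (H : Set V)) hdim₁
  haveI := M.isPrime_relIdeal
  obtain ⟨ρ₂, a₂, γ₂, -, hs₂⟩ :=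
    ZeroEst.exists_sandwich_of_isPrime (𝔭 := M.relIdeal) M.ringKrullDim_quotient_relIdeal
  have key : s + d₁ ≤ M.dim + 1 := by
    refine add_le_of_choose_mul_choose_le (ρ₂ := ρ₂) (a₁ := a₁) (γ₂ := γ₂ + (1 + c') * a₂) (c := 1 + c')
      (t₀ := a₁ + a₂) hρ₁ fun t ht => ?_
    have e1 := (hs₁ t (by omega)).1
    have e2 := hc' t t
    have e3 := (hs₂ (t + c' * t) (by nlinarith)).2
    calc (t + s).choose s * (ρ₁ * (t - a₁ + d₁).choose d₁)
        ≤ (t + s).choose s * ZeroEst.hilbC ((M.vanishing (H : Set V)).restrictScalars ℂ) t :=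
          Nat.mul_le_mul_left _ e1
      _ ≤ ZeroEst.hilbC (N := N) (M.relIdeal.restrictScalars ℂ) (t + c' * t) := e2
      _ ≤ ρ₂ * (t + c' * t + γ₂ + (M.dim + 1)).choose (M.dim + 1) := e3
      _ ≤ ρ₂ * ((1 + c') * t + (γ₂ + (1 + c') * a₂) + (M.dim + 1)).choose (M.dim + 1) :=
          Nat.mul_le_mul_left _ (Nat.choose_le_choose _ (by nlinarith))
  omega

end DimBound

end AnalyticGroupModel

/-! ## The theta model of `M_κ` -/

namespace GaGmE

namespace Std

variable {β γ δ : Type} [Fintype β] [Fintype γ] [Fintype δ] [DecidableEq γ]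
variable (L : PeriodPair) (κM : δ → γ → Kbar)

/-! ### Step B3: explicit equations for `Lie(hull) + ker` -/

omit [Fintype β] [Fintype δ] [DecidableEq γ] in
/-- Some uncorrected product `∏_b P_{M b}(z'_b)` does not vanish at `w`. [folklore] -/
theorem exists_thetaPnone_ne_zero (w : β ⊕ (γ ⊕ δ) → ℂ) :
    ∃ Mc : γ → Fin 3, thetaPnone (β := β) (δ := δ) L Mc w ≠ 0 := by
  classical
  let Mc : γ → Fin 3 := fun b => if w (iz b) ∈ L.lattice then 2 else 0
  have hM : ∀ b, L.univExtP (Mc b) (w (iz b)) ≠ 0 := by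
    intro b
    by_cases hb : w (iz b) ∈ L.lattice
    · obtain ⟨m', n', hmn⟩ := PeriodPair.mem_lattice.mp hb
      obtain ⟨c, hc, -, -, h2, -⟩ := L.exists_univExtTheta_lattice m' n' 0
      simp only [PeriodPair.univExtTheta_inl] at h2
      have : Mc b = 2 := if_pos hb
      rw [this, ← hmn, h2]
      exact mul_ne_zero hc (by norm_num)
    · have : Mc b = 0 := if_neg hb
      rw [this, (PeriodPair.univExtP_eq hb).1]
      exact pow_ne_zero _ (L.weierstrassSigma_ne_zero hb)
  exact ⟨Mc, Finset.prod_ne_zero_iff.mpr fun b _ => hM b⟩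

omit [Fintype β] [Fintype γ] [Fintype δ] [DecidableEq γ] in
/-- `P₀(z) = σ(z)³` vanishes exactly on the lattice. [folklore] -/
theorem univExtP_zero_eq_zero_iff (z : ℂ) : L.univExtP 0 z = 0 ↔ z ∈ L.lattice := by
  constructor
  · intro h
    by_contra hz
    rw [(PeriodPair.univExtP_eq hz).1] at h
    exact pow_ne_zero _ (L.weierstrassSigma_ne_zero hz) h
  · intro hz
    obtain ⟨m, n, hmn⟩ := PeriodPair.mem_lattice.mp hz
    obtain ⟨c, -, h0, -⟩ := L.exists_univExtTheta_lattice m n 0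
    simp only [PeriodPair.univExtTheta_inl] at h0
    rw [← hmn, h0]

omit [Fintype β] [Fintype δ] in
/-- `F_{X_{(none,(0,none))}}(x) = ∏_b P₀(z'_b(x))`. [folklore] -/
theorem thetaEval_X_zero (x : β ⊕ (γ ⊕ δ) → ℂ) :
    thetaEval L κM (X (none, ((fun _ => 0 : γ → Fin 3), none))) x = ∏ b, L.univExtP 0 (x (iz b)) := by
  rw [thetaEval_X]
  simp [theta, thetaPnone]

omit [Fintype β] [Fintype δ] in
/-- `F_{P - Q} = F_P - F_Q`. [folklore] -/
theorem thetaEval_sub (P Q : MvPolynomial (Option β × ThetaIdx γ δ) ℂ) (w : β ⊕ (γ ⊕ δ) → ℂ) :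
    thetaEval L κM (P - Q) w = thetaEval L κM P w - thetaEval L κM Q w := by
  simp [thetaEval]

omit [Fintype β] [Fintype δ] in
/-- `F_{X_J^k} = Θ_J^k`. [folklore] -/
theorem thetaEval_X_pow (J : Option β × ThetaIdx γ δ) (k : ℕ) (w : β ⊕ (γ ⊕ δ) → ℂ) :
    thetaEval L κM (X J ^ k) w = theta L κM J w ^ k := by
  simp [thetaEval]

omit [Fintype δ] in
/-- Products of powers of the torus coordinates over a fixed `P_κ`-index:
`F_{∏_j X_{(some j, I)}^{a_j}}(x) = e^{∑ a_j y'_j} Θ^P_I(x)^{∑ a_j}`. [folklore] -/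
theorem thetaEval_prod_X_some_pow (I : ThetaIdx γ δ) (a : β → ℕ) (x : β ⊕ (γ ⊕ δ) → ℂ) :
    thetaEval L κM (∏ j, X (some j, I) ^ a j) x =
      cexp (∑ j, (a j : ℂ) * x (iy j)) * thetaP L κM I x ^ (∑ j, a j) := by
  simp only [thetaEval, map_prod, map_pow, eval_X, theta, thetaT_some, mul_pow,
    Finset.prod_mul_distrib, Finset.prod_pow_eq_pow_sum, exp_sum]
  congr 1
  refine Finset.prod_congr rfl fun j _ => ?_
  rw [← exp_nat_mul]

/-- **The binomial form of an integer character** `q = q⁺ - q⁻` of `𝔾ₘ^β` (over the `P_κ`-index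
`I`): `∏_j X_{(some j,I)}^{q⁺_j} X_{(none,I)}^{|q⁻|} - ∏_j X_{(some j,I)}^{q⁻_j} X_{(none,I)}^{|q⁺|}`.
[folklore] -/
def binomForm (q : β → ℤ) (I : ThetaIdx γ δ) : MvPolynomial (Option β × ThetaIdx γ δ) ℂ :=
  (∏ j, X (some j, I) ^ (q j).toNat) * X (none, I) ^ (∑ j, (-q j).toNat) -
    (∏ j, X (some j, I) ^ (-q j).toNat) * X (none, I) ^ (∑ j, (q j).toNat)

omit [Fintype γ] [Fintype δ] [DecidableEq γ] in
/-- The binomial form is homogeneous of degree `|q⁺| + |q⁻|`. [folklore] -/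
theorem isHomogeneous_binomForm (q : β → ℤ) (I : ThetaIdx γ δ) :
    (binomForm q I).IsHomogeneous (∑ j, (q j).toNat + ∑ j, (-q j).toNat) := by
  unfold binomForm
  refine IsHomogeneous.sub ?_ ?_
  · have h1 : (∏ j, X (some j, I) ^ (q j).toNat : MvPolynomial (Option β × ThetaIdx γ δ) ℂ).IsHomogeneous
        (∑ j ∈ Finset.univ, 1 * (q j).toNat) :=
      IsHomogeneous.prod _ _ _ fun j _ => (isHomogeneous_X ℂ _).pow _
    have h2 : (X (none, I) ^ (∑ j, (-q j).toNat) : MvPolynomial (Option β × ThetaIdx γ δ) ℂ).IsHomogeneous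
        (1 * ∑ j, (-q j).toNat) := (isHomogeneous_X ℂ _).pow _
    simpa using h1.mul h2
  · have h1 : (∏ j, X (some j, I) ^ (-q j).toNat : MvPolynomial (Option β × ThetaIdx γ δ) ℂ).IsHomogeneous
        (∑ j ∈ Finset.univ, 1 * (-q j).toNat) :=
      IsHomogeneous.prod _ _ _ fun j _ => (isHomogeneous_X ℂ _).pow _
    have h2 : (X (none, I) ^ (∑ j, (q j).toNat) : MvPolynomial (Option β × ThetaIdx γ δ) ℂ).IsHomogeneous
        (1 * ∑ j, (q j).toNat) := (isHomogeneous_X ℂ _).pow _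
    simpa [add_comm] using h1.mul h2

omit [Fintype δ] in
/-- **Values of the binomial form**:
`F(x) = Θ^P_I(x)^{|q⁺|+|q⁻|} · e^{⟨q⁻, y'⟩} · (e^{⟨q, y'⟩} - 1)`. [folklore] -/
theorem thetaEval_binomForm (q : β → ℤ) (I : ThetaIdx γ δ) (x : β ⊕ (γ ⊕ δ) → ℂ) :
    thetaEval L κM (binomForm q I) x =
      thetaP L κM I x ^ (∑ j, (q j).toNat + ∑ j, (-q j).toNat) *
        cexp (∑ j, ((-q j).toNat : ℂ) * x (iy j)) * (cexp (∑ j, (q j : ℂ) * x (iy j)) - 1) := by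
  have hq : ∀ j, ((q j).toNat : ℂ) = (q j : ℂ) + ((-q j).toNat : ℂ) := by
    intro j
    have h := Int.toNat_sub_toNat_neg (q j)
    have h' : ((q j).toNat : ℤ) = q j + ((-q j).toNat : ℤ) := by omega
    exact_mod_cast congrArg (fun z : ℤ => (z : ℂ)) h'
  have hexp : cexp (∑ j, ((q j).toNat : ℂ) * x (iy j)) =
      cexp (∑ j, (q j : ℂ) * x (iy j)) * cexp (∑ j, ((-q j).toNat : ℂ) * x (iy j)) := by
    rw [← exp_add, ← Finset.sum_add_distrib]
    congr 1
    refine Finset.sum_congr rfl fun j _ => ?_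
    rw [hq j]; ring
  unfold binomForm
  rw [thetaEval_sub, thetaEval_mul, thetaEval_mul, thetaEval_prod_X_some_pow, thetaEval_prod_X_some_pow,
    thetaEval_X_pow, thetaEval_X_pow]
  simp only [theta, thetaT_none, one_mul]
  rw [hexp]
  ring

/-- **The linear forms of the vector part**: `∑_e ξ_e X_{(none,(M, some e))}`. [folklore] -/
def linForm (ξ : δ → ℂ) (Mc : γ → Fin 3) : MvPolynomial (Option β × ThetaIdx γ δ) ℂ :=
  ∑ e, C (ξ e) * X (none, (Mc, some e))

omit [Fintype β] [Fintype γ] [DecidableEq γ] in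
/-- The linear forms are homogeneous of degree `1`. [folklore] -/
theorem isHomogeneous_linForm (ξ : δ → ℂ) (Mc : γ → Fin 3) :
    (linForm (β := β) ξ Mc).IsHomogeneous 1 := by
  unfold linForm
  refine IsHomogeneous.sum _ _ _ fun e _ => ?_
  simpa using (isHomogeneous_C _ (ξ e)).mul (isHomogeneous_X ℂ (none, (Mc, some e)))

omit [Fintype β] in
/-- **Values of the linear forms**: `F(x) = ⟨ξ, s(x)⟩ ∏_b P_{M b}(z'_b) -
∑_b ⟨ξ, κ_{·b}⟩ Z_{M b}(z'_b) ∏_{b' ≠ b} P_{M b'}(z'_{b'})`. [folklore] -/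
theorem thetaEval_linForm (ξ : δ → ℂ) (Mc : γ → Fin 3) (x : β ⊕ (γ ⊕ δ) → ℂ) :
    thetaEval L κM (linForm ξ Mc) x =
      (∑ e, ξ e * x (is e)) * thetaPnone (β := β) (δ := δ) L Mc x -
        ∑ b, (∑ e, ξ e * (κM e b : ℂ)) * (L.univExtZ (Mc b) (x (iz b)) *
          ∏ b' ∈ Finset.univ.erase b, L.univExtP (Mc b') (x (iz b'))) := by
  unfold linForm
  simp only [thetaEval, map_sum, map_mul, eval_C, eval_X, theta, thetaT_none, one_mul, thetaP_some,
    thetaPsome]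
  simp only [mul_sub, Finset.sum_sub_distrib, Finset.sum_mul, Finset.mul_sum]
  congr 1
  · exact Finset.sum_congr rfl fun e _ => by ring
  · rw [Finset.sum_comm]
    exact Finset.sum_congr rfl fun b _ => Finset.sum_congr rfl fun e _ => by ring

omit [Fintype β] in
/-- On `z' = 0` the linear form with `M ≡ 2` is `(-2)^{|γ|} ⟨ξ, s⟩` (`P₂(0) = -2`, `Z₂(0) = 0`).
[folklore] -/
theorem thetaEval_linForm_two_of_z_eq_zero (ξ : δ → ℂ) {x : β ⊕ (γ ⊕ δ) → ℂ} (hx : ∀ b, x (iz b) = 0) :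
    thetaEval L κM (linForm ξ (fun _ => (2 : Fin 3))) x = (∑ e, ξ e * x (is e)) * (-2) ^ Fintype.card γ := by
  rw [thetaEval_linForm]
  have hZ : ∀ b, L.univExtZ 2 (x (iz b)) = 0 := fun b => by rw [hx b]; exact L.univExtZ_at_zero.2.2
  have hP : ∀ b, L.univExtP 2 (x (iz b)) = -2 := fun b => by rw [hx b]; exact L.univExtP_at_zero.2.2
  simp only [hZ, zero_mul, mul_zero, Finset.sum_const_zero, sub_zero, thetaPnone, hP,
    Finset.prod_const, Finset.card_univ]

omit [Fintype β] in
/-- When `⟨ξ, κ_{·b}⟩ = 0` for all `b`, the linear form is `⟨ξ, s⟩ ∏_b P_{M b}(z'_b)`. [folklore] -/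
theorem thetaEval_linForm_of_perp (ξ : δ → ℂ) (Mc : γ → Fin 3) (hκ : ∀ b, ∑ e, ξ e * (κM e b : ℂ) = 0)
    (x : β ⊕ (γ ⊕ δ) → ℂ) :
    thetaEval L κM (linForm ξ Mc) x = (∑ e, ξ e * x (is e)) * thetaPnone (β := β) (δ := δ) L Mc x := by
  rw [thetaEval_linForm]
  simp [hκ]

omit [Fintype β] [Fintype δ] [DecidableEq γ] in
/-- The torus kernel vector `(2πi m; 0; 0) ∈ ker(exp_{M_κ})`. [folklore] -/
theorem coords_two_pi_I_mem_ker (mm : β → ℤ) :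
    coords (fun j => 2 * Real.pi * I * (mm j : ℂ)) (0 : γ → ℂ) (0 : δ → ℂ) ∈ ker L κM :=
  ⟨fun j => ⟨mm j, by simp; ring⟩, 0, 0, fun b => by simp, fun e => by simp⟩

/-- **The closure of a subspace lies in `exp⁻¹` of its hull** (at most one elliptic factor,
complex multiplication allowed): a point `w` at which every FORM vanishing on `𝔥` vanishes lies in
`Lie(hull 𝔥) + ker(exp_{M_κ})`. The equations used: `X_{(none,(0,none))}` (`= σ(z')³`, forcing
`z' ∈ Λ` when `z' ≡ 0` on `𝔥`), the binomial forms of the integer characters `q ∈ yRel 𝔥`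
(forcing `e^{⟨q, y'⟩} = 1`, whence `y' ∈ (yRel 𝔥)^⊥ + 2πiℤ^β` by saturation), and the linear
forms `∑_e ξ_e X_{(none,(M,some e))}`, `ξ ∈ sRel 𝔥` (forcing the `s`-conditions of the hull, after
the kernel correction over `z'`). [folklore] -/
theorem mem_preimageSubgroup_hull_of_forall_thetaEval (hγ : Fintype.card γ ≤ 1)
    (𝔥 : Submodule ℂ (β ⊕ (γ ⊕ δ) → ℂ)) {w : β ⊕ (γ ⊕ δ) → ℂ}
    (hw : ∀ (D : ℕ) (P : MvPolynomial (Option β × ThetaIdx γ δ) ℂ), P.IsHomogeneous D →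
      (∀ x ∈ 𝔥, thetaEval L κM P x = 0) → thetaEval L κM P w = 0) :
    w ∈ preimageSubgroup L κM (hullData κM 𝔥) := by
  classical
  haveI : Subsingleton γ := Fintype.card_le_one_iff_subsingleton.mp hγ
  obtain ⟨Mc, hMc⟩ := exists_thetaPnone_ne_zero (β := β) (δ := δ) L w
  -- (Y) the integer characters of `yRel 𝔥` are trivial at `y'(w)`
  have hY : ∀ q : β → ℤ, (fun j => (q j : ℚ)) ∈ yRel 𝔥 → cexp (∑ j, (q j : ℂ) * w (iy j)) = 1 := by
    intro q hq
    by_contra hne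
    have hvan : ∀ x ∈ 𝔥, thetaEval L κM (binomForm q (Mc, none)) x = 0 := by
      intro x hx
      have h0 : ∑ j, (q j : ℂ) * x (iy j) = 0 := by
        have := (mem_yRel_iff 𝔥).mp hq x hx
        simpa using this
      rw [thetaEval_binomForm, h0, exp_zero, sub_self, mul_zero]
    have := hw _ _ (isHomogeneous_binomForm q (Mc, none)) hvan
    rw [thetaEval_binomForm, thetaP_none] at this
    rcases mul_eq_zero.mp this with h | h
    · rcases mul_eq_zero.mp h with h | h
      · exact hMc (pow_eq_zero_iff'.mp h).1
      · exact exp_ne_zero _ h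
    · exact hne (sub_eq_zero.mp h)
  obtain ⟨mm, hmm⟩ := exists_int_shift_of_forall_exp_eq_one (yRel 𝔥) (fun j => w (iy j)) hY
  -- the torus part of the decomposition
  set y₁ : β → ℂ := fun j => w (iy j) - 2 * Real.pi * I * (mm j) with hy₁
  have hy₁A : ∀ q ∈ yRel 𝔥, ∑ j, (q j : ℂ) * y₁ j = 0 := fun q hq => hmm q hq
  have hkT : coords (fun j => 2 * Real.pi * I * (mm j : ℂ)) (0 : γ → ℂ) (0 : δ → ℂ) ∈
      AddSubgroup.closure (ker L κM) := AddSubgroup.subset_closure (coords_two_pi_I_mem_ker L κM mm)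
  by_cases hz : ZFlat 𝔥
  · -- `z' ≡ 0` on `𝔥`: the `E`-coordinates of `w` are lattice points
    have hzΛ : ∀ b, w (iz b) ∈ L.lattice := by
      intro b
      have hvan : ∀ x ∈ 𝔥, thetaEval L κM (X (none, ((fun _ => 0 : γ → Fin 3), none))) x = 0 := by
        intro x hx
        rw [thetaEval_X_zero]
        exact Finset.prod_eq_zero (Finset.mem_univ b)
          ((univExtP_zero_eq_zero_iff L _).mpr (by rw [hz.eq_zero x hx b]; exact L.lattice.zero_mem))
      have := hw 1 _ (isHomogeneous_X ℂ _) hvan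
      rw [thetaEval_X_zero] at this
      obtain ⟨b', -, hb'⟩ := Finset.prod_eq_zero_iff.mp this
      rw [Subsingleton.elim b b']
      exact (univExtP_zero_eq_zero_iff L _).mp hb'
    choose m n hmn using fun b => PeriodPair.mem_lattice.mp (hzΛ b)
    set k₀ : β ⊕ (γ ⊕ δ) → ℂ := coords (0 : β → ℂ) (fun b => (m b : ℂ) * L.ω₁ + (n b : ℂ) * L.ω₂)
      (fun e => ∑ b, (κM e b : ℂ) * ((m b : ℂ) * L.η₁ + (n b : ℂ) * L.η₂)) with hk₀
    have hk₀mem : k₀ ∈ ker L κM := coords_lattice_mem_ker L κM m n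
    set s₁ : δ → ℂ := fun e => w (is e) - ∑ b, (κM e b : ℂ) * ((m b : ℂ) * L.η₁ + (n b : ℂ) * L.η₂) with hs₁
    have hw₁ : w = coords (yPart w) (0 : γ → ℂ) s₁ + k₀ := by
      rw [hk₀, ← coords_add]
      conv_lhs => rw [← coords_yPart_zPart_sPart w]
      congr 1 <;> funext i <;> simp [hs₁, hmn]
    -- (S) the `s`-conditions of the hull hold for `s₁`
    have hS : ∀ ξ ∈ sRel κM 𝔥, ∑ e, ξ e * s₁ e = 0 := by
      intro ξ hξ
      by_contra hne
      have hvan : ∀ x ∈ 𝔥, thetaEval L κM (linForm ξ (fun _ => (2 : Fin 3))) x = 0 := by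
        intro x hx
        rw [thetaEval_linForm_two_of_z_eq_zero L κM ξ (hz.eq_zero x hx), hξ.1 x hx, zero_mul]
      have h1 := hw 1 _ (isHomogeneous_linForm ξ _) hvan
      rw [hw₁, thetaEval_add_ker_eq_zero_iff L κM (isHomogeneous_linForm ξ _) hk₀mem,
        thetaEval_linForm_two_of_z_eq_zero L κM ξ (fun b => by simp)] at h1
      simp only [coords_is] at h1
      exact hne ((mul_eq_zero.mp h1).resolve_right (pow_ne_zero _ (by norm_num)))
    -- assemble
    have ht : coords y₁ (0 : γ → ℂ) s₁ ∈ (hullData κM 𝔥).tangent := by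
      rw [mem_hull_tangent_iff]
      refine ⟨fun q hq => by simpa using hy₁A q hq, fun _ b => by simp, fun ξ hξ => by simpa using hS ξ hξ⟩
    have hsplit : coords (yPart w) (0 : γ → ℂ) s₁ =
        coords y₁ (0 : γ → ℂ) s₁ + coords (fun j => 2 * Real.pi * I * (mm j : ℂ)) (0 : γ → ℂ) (0 : δ → ℂ) := by
      rw [← coords_add]
      congr 1 <;> funext i <;> simp [hy₁]
    rw [hw₁, hsplit, add_assoc]
    exact AddSubgroup.add_mem _ (AddSubgroup.mem_sup_left ht)
      (AddSubgroup.mem_sup_right (AddSubgroup.add_mem _ hkT (AddSubgroup.subset_closure hk₀mem)))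
  · -- `z' ≢ 0` on `𝔥`: no `E`-condition, and `ξ ⊥ κ` for `ξ ∈ sRel`
    have hS : ∀ ξ ∈ sRel κM 𝔥, ∑ e, ξ e * w (is e) = 0 := by
      intro ξ hξ
      by_contra hne
      have hvan : ∀ x ∈ 𝔥, thetaEval L κM (linForm ξ Mc) x = 0 := by
        intro x hx
        rw [thetaEval_linForm_of_perp L κM ξ Mc (hξ.2 hz), hξ.1 x hx, zero_mul]
      have h1 := hw 1 _ (isHomogeneous_linForm ξ _) hvan
      rw [thetaEval_linForm_of_perp L κM ξ Mc (hξ.2 hz)] at h1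
      exact hne ((mul_eq_zero.mp h1).resolve_right hMc)
    have ht : coords y₁ (zPart w) (sPart w) ∈ (hullData κM 𝔥).tangent := by
      rw [mem_hull_tangent_iff]
      refine ⟨fun q hq => by simpa using hy₁A q hq, fun h => absurd h hz, fun ξ hξ => by simpa using hS ξ hξ⟩
    have hdec : w = coords y₁ (zPart w) (sPart w) +
        coords (fun j => 2 * Real.pi * I * (mm j : ℂ)) (0 : γ → ℂ) (0 : δ → ℂ) := by
      rw [← coords_add]
      conv_lhs => rw [← coords_yPart_zPart_sPart w]
      congr 1 <;> funext i <;> simp [hy₁]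
    rw [hdec]
    exact AddSubgroup.add_mem _ (AddSubgroup.mem_sup_left ht) (AddSubgroup.mem_sup_right hkT)

/-! ### Theta models: the dictionary `M.F ↔ thetaEval` -/

section Model

variable {N : ℕ} (M : AnalyticGroupModel (β ⊕ (γ ⊕ δ) → ℂ) N) (e : Option β × ThetaIdx γ δ ≃ Fin (N + 1))

attribute [local instance] MvPolynomial.gradedAlgebra


variable (hΘ : ∀ J w, M.Θ (e J) w = theta L κM J w)
include hΘ

/-- `F_{P ∘ e}(w) = F_P(w)` in the notation of `thetaEval`. [folklore] -/
theorem F_rename (P : MvPolynomial (Option β × ThetaIdx γ δ) ℂ) (w : β ⊕ (γ ⊕ δ) → ℂ) :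
    M.F (rename e P) w = thetaEval L κM P w := by
  rw [AnalyticGroupModel.F_apply, eval_rename]
  unfold thetaEval
  congr 2
  funext J
  exact hΘ J w

/-- `M.F P = F_{P ∘ e⁻¹}`. [folklore] -/
theorem F_eq_thetaEval (P : MvPolynomial (Fin (N + 1)) ℂ) (w : β ⊕ (γ ⊕ δ) → ℂ) :
    M.F P w = thetaEval L κM (rename e.symm P) w := by
  rw [← F_rename L κM M e hΘ, rename_rename, e.self_comp_symm, rename_id, AlgHom.id_apply]

/-- A form vanishing on `X` (through `thetaEval`) vanishes on the closure `Z(𝔍(X))`. [folklore] -/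
theorem thetaEval_eq_zero_of_mem_zeroSet {X : Set (β ⊕ (γ ⊕ δ) → ℂ)}
    {P : MvPolynomial (Option β × ThetaIdx γ δ) ℂ} {D : ℕ} (hP : P.IsHomogeneous D)
    (h : ∀ x ∈ X, thetaEval L κM P x = 0) {w : β ⊕ (γ ⊕ δ) → ℂ}
    (hw : w ∈ M.zeroSet ((M.vanishing X : Ideal _) : Set (MvPolynomial (Fin (N + 1)) ℂ))) :
    thetaEval L κM P w = 0 := by
  have hmem : rename e P ∈ M.vanishing X := by
    rw [M.mem_vanishing_iff_of_isHomogeneous hP.rename_isHomogeneous]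
    intro x hx
    rw [F_rename L κM M e hΘ]
    exact h x hx
  have := M.F_eq_zero_of_mem_of_mem_zeroSet hmem hw
  rwa [F_rename L κM M e hΘ] at this

/-- **Closedness through `thetaEval`**: a point at which every form vanishing on the closed set
`X` vanishes lies in `X`. [folklore] -/
theorem mem_of_isClosedG {X : Set (β ⊕ (γ ⊕ δ) → ℂ)} (hX : M.IsClosedG X) {w : β ⊕ (γ ⊕ δ) → ℂ}
    (h : ∀ (D : ℕ) (P : MvPolynomial (Option β × ThetaIdx γ δ) ℂ), P.IsHomogeneous D →
      (∀ x ∈ X, thetaEval L κM P x = 0) → thetaEval L κM P w = 0) : w ∈ X := by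
  rw [← hX.eq, M.mem_zeroSet_iff_forall_isHomogeneous (M.isHomogeneous_vanishing X)]
  intro P hP d hd
  rw [F_eq_thetaEval L κM M e hΘ]
  refine h d _ hd.rename_isHomogeneous fun x hx => ?_
  rw [← F_eq_thetaEval L κM M e hΘ]
  exact (M.mem_vanishing_iff_of_isHomogeneous hd).mp hP x hx

/-- A closed set is a union of fibres of `exp_{M_κ}` (automorphy of `Θ` under the kernel). [folklore] -/
theorem add_mem_of_isClosedG_of_mem_ker {X : Set (β ⊕ (γ ⊕ δ) → ℂ)} (hX : M.IsClosedG X)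
    {x : β ⊕ (γ ⊕ δ) → ℂ} (hx : x ∈ X) {k : β ⊕ (γ ⊕ δ) → ℂ} (hk : k ∈ ker L κM) : x + k ∈ X :=
  mem_of_isClosedG L κM M e hΘ hX fun _ _ hP hvan =>
    (thetaEval_add_ker_eq_zero_iff L κM hP hk x).mpr (hvan x hx)

/-! ### Step A: the hull of the lineality space -/

/-- `Lie(hull 𝒯(H)) ⊆ H` for a closed subgroup `H` (hull theorem + closedness). [folklore] -/
theorem hull_tangent_subset (hγ : Fintype.card γ ≤ 1) {H : AddSubgroup (β ⊕ (γ ⊕ δ) → ℂ)}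
    (hH : M.IsClosedG (H : Set (β ⊕ (γ ⊕ δ) → ℂ))) :
    ((hullData κM (AnalyticGroupModel.linSpace (H : Set (β ⊕ (γ ⊕ δ) → ℂ)))).tangent :
      Set (β ⊕ (γ ⊕ δ) → ℂ)) ⊆ H := by
  intro w hw
  exact mem_of_isClosedG L κM M e hΘ hH fun D P hP hvan =>
    thetaEval_eq_zero_on_hull hγ _ hP (fun x hx => hvan x (AnalyticGroupModel.linSpace_subset H hx)) w hw

/-- **`Lie(hull 𝒯(H)) = 𝒯(H)`** for a closed subgroup `H`, `|γ| ≤ 1`. [folklore] -/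
theorem tangent_hull_linSpace_eq (hγ : Fintype.card γ ≤ 1) {H : AddSubgroup (β ⊕ (γ ⊕ δ) → ℂ)}
    (hH : M.IsClosedG (H : Set (β ⊕ (γ ⊕ δ) → ℂ))) :
    (hullData κM (AnalyticGroupModel.linSpace (H : Set (β ⊕ (γ ⊕ δ) → ℂ)))).tangent =
      AnalyticGroupModel.linSpace (H : Set (β ⊕ (γ ⊕ δ) → ℂ)) :=
  le_antisymm (AnalyticGroupModel.le_linSpace_of_subset (hull_tangent_subset L κM M e hΘ hγ hH))
    (le_hull_tangent κM _)

/-- `ker(exp) ⊆ H` for a closed subgroup `H`. [folklore] -/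
theorem ker_subset_of_isClosedG {H : AddSubgroup (β ⊕ (γ ⊕ δ) → ℂ)}
    (hH : M.IsClosedG (H : Set (β ⊕ (γ ⊕ δ) → ℂ))) : ker L κM ⊆ (H : Set (β ⊕ (γ ⊕ δ) → ℂ)) := by
  intro k hk
  have := add_mem_of_isClosedG_of_mem_ker L κM M e hΘ hH H.zero_mem hk
  rwa [zero_add] at this

/-- **`exp⁻¹(hull) ⊆ H`**: `Lie(hull 𝒯(H)) + ker ⊆ H` for a closed subgroup `H`, `|γ| ≤ 1`. [folklore] -/
theorem preimageSubgroup_hull_le (hγ : Fintype.card γ ≤ 1) {H : AddSubgroup (β ⊕ (γ ⊕ δ) → ℂ)}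
    (hH : M.IsClosedG (H : Set (β ⊕ (γ ⊕ δ) → ℂ))) :
    preimageSubgroup L κM (hullData κM (AnalyticGroupModel.linSpace (H : Set (β ⊕ (γ ⊕ δ) → ℂ)))) ≤ H := by
  refine sup_le (fun w hw => hull_tangent_subset L κM M e hΘ hγ hH hw) ?_
  rw [AddSubgroup.closure_le]
  exact ker_subset_of_isClosedG L κM M e hΘ hH

/-! ### Step B1: the Hilbert function of the ideal of `Lie G'` -/

omit [DecidableEq γ] hΘ in
/-- The hockey stick `∑_{d ≤ t} binom(d + m, m) = binom(t + m + 1, m + 1)`. [folklore] -/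
theorem sum_fin_add_choose (t m : ℕ) :
    ∑ d : Fin (t + 1), ((d : ℕ) + m).choose m = (t + m + 1).choose (m + 1) := by
  rw [Fin.sum_univ_eq_sum_range (fun d => (d + m).choose m) (t + 1)]
  exact Nat.sum_range_add_choose t m

/-- **`H(𝔍(Lie G'); t) ≥ binom(t + dim G' + 1, dim G' + 1)`** (cumulative Hilbert function of the
ideal of the cone over `Lie G'`, `G'` any connected algebraic subgroup datum `K`): the
`binom(d + m, m)` degree-`d` forms of `PkappaThetaCosetHilbert.lean` for all `d ≤ t` are linearly
independent modulo `𝔍(Lie G')` (on the cone the variable `c` separates the degrees).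
[cite: NesterenkoPhilippon2001, Ch. 11 Prop. 2.3, Thm. 4.1 (ℋ(H₀; D) ≥ D^{dim H₀})] -/
theorem choose_le_hilbC_vanishing_tangent (K : SubgroupDataC β γ δ κM) (t : ℕ) :
    (t + finrank ℂ K.tangent + 1).choose (finrank ℂ K.tangent + 1) ≤
      ZeroEst.hilbC ((M.vanishing (K.tangent : Set (β ⊕ (γ ⊕ δ) → ℂ))).restrictScalars ℂ) t := by
  classical
  set m := finrank ℂ K.tangent with hm
  set T := K.tangent with hT
  -- the families in each degree `d ≤ t`
  have hfam := fun d : Fin (t + 1) => exists_linearIndependent_thetaEval_coset L K 0 (d : ℕ) (κM := κM)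
  choose n P hn hhom hli using hfam
  -- the evaluation map on the cone over `Lie G'`
  let Ψ : ZeroEst.Fil (N := N) t →ₗ[ℂ] (ℂ × T → ℂ) :=
    { toFun := fun Q p => eval (p.1 • M.pt (p.2 : β ⊕ (γ ⊕ δ) → ℂ)) (Q : MvPolynomial (Fin (N + 1)) ℂ)
      map_add' := fun Q Q' => by funext p; simp
      map_smul' := fun c Q => by funext p; simp [smul_eval] }
  have hΨapply : ∀ (Q : ZeroEst.Fil (N := N) t) (p : ℂ × T),
      Ψ Q p = eval (p.1 • M.pt (p.2 : β ⊕ (γ ⊕ δ) → ℂ)) (Q : MvPolynomial (Fin (N + 1)) ℂ) := fun _ _ => rfl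
  -- its kernel is `Fil t ∩ 𝔍(Lie G')`
  have hker : LinearMap.ker Ψ =
      ((M.vanishing (T : Set (β ⊕ (γ ⊕ δ) → ℂ))).restrictScalars ℂ).comap (ZeroEst.Fil (N := N) t).subtype := by
    ext Q
    simp only [LinearMap.mem_ker, Submodule.mem_comap, Submodule.coe_subtype, Submodule.restrictScalars_mem]
    rw [M.mem_vanishing_iff]
    constructor
    · intro h w hw c
      have := congr_fun h (c, ⟨w, hw⟩)
      rwa [hΨapply] at this
    · intro h
      funext p
      rw [hΨapply]
      exact h _ p.2.2 p.1
  have hkerdim : finrank ℂ (LinearMap.ker Ψ) =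
      finrank ℂ ↥(ZeroEst.Fil (N := N) t ⊓ (M.vanishing (T : Set (β ⊕ (γ ⊕ δ) → ℂ))).restrictScalars ℂ) := by
    rw [hker]
    have e1 : Submodule.comap (ZeroEst.Fil (N := N) t).subtype
        ((M.vanishing (T : Set (β ⊕ (γ ⊕ δ) → ℂ))).restrictScalars ℂ) =
        Submodule.comap (ZeroEst.Fil (N := N) t).subtype
          (ZeroEst.Fil t ⊓ (M.vanishing (T : Set (β ⊕ (γ ⊕ δ) → ℂ))).restrictScalars ℂ) := by
      rw [Submodule.comap_inf, Submodule.comap_subtype_self, top_inf_eq]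
    rw [e1]
    exact (Submodule.comapSubtypeEquivOfLe inf_le_left).finrank_eq
  have hH : ZeroEst.hilbC ((M.vanishing (T : Set (β ⊕ (γ ⊕ δ) → ℂ))).restrictScalars ℂ) t =
      finrank ℂ (LinearMap.range Ψ) := by
    have h1 := ZeroEst.hilbC_add_finrank_inf (N := N) ((M.vanishing (T : Set (β ⊕ (γ ⊕ δ) → ℂ))).restrictScalars ℂ) t
    have h2 := LinearMap.finrank_range_add_finrank_ker Ψ
    omega
  rw [hH]
  -- the combined family
  have hmemFil : ∀ i : (Σ d : Fin (t + 1), Fin (n d)), rename e (P i.1 i.2) ∈ ZeroEst.Fil (N := N) t := fun i =>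
    ZeroEst.mem_Fil.mpr (((hhom i.1 i.2).rename_isHomogeneous.totalDegree_le).trans (Nat.lt_succ_iff.mp i.1.2))
  let f : (Σ d : Fin (t + 1), Fin (n d)) → ZeroEst.Fil (N := N) t := fun i => ⟨rename e (P i.1 i.2), hmemFil i⟩
  have hΨf : ∀ (i : Σ d : Fin (t + 1), Fin (n d)) (p : ℂ × T),
      Ψ (f i) p = p.1 ^ (i.1 : ℕ) * thetaEval L κM (P i.1 i.2) (p.2 : β ⊕ (γ ⊕ δ) → ℂ) := by
    intro i p
    rw [hΨapply]
    show eval (p.1 • M.pt (p.2 : β ⊕ (γ ⊕ δ) → ℂ)) (rename e (P i.1 i.2)) = _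
    rw [M.eval_smul_pt (hhom i.1 i.2).rename_isHomogeneous, F_rename L κM M e hΘ]
  have hliΨ : LinearIndependent ℂ fun i : (Σ d : Fin (t + 1), Fin (n d)) => Ψ (f i) := by
    rw [Fintype.linearIndependent_iff]
    intro a ha
    have hcw : ∀ (w : T) (c : ℂ), ∑ d : Fin (t + 1), c ^ (d : ℕ) *
        ∑ k : Fin (n d), a ⟨d, k⟩ * thetaEval L κM (P d k) (w : β ⊕ (γ ⊕ δ) → ℂ) = 0 := by
      intro w c
      have := congr_fun ha (c, w)
      simp only [Finset.sum_apply, Pi.smul_apply, smul_eq_mul, Pi.zero_apply] at this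
      rw [← this, ← Finset.univ_sigma_univ, Finset.sum_sigma]
      refine Finset.sum_congr rfl fun d _ => ?_
      rw [Finset.mul_sum]
      refine Finset.sum_congr rfl fun k _ => ?_
      rw [hΨf]; ring
    have hcoef : ∀ (w : T) (d : Fin (t + 1)),
        ∑ k : Fin (n d), a ⟨d, k⟩ * thetaEval L κM (P d k) (w : β ⊕ (γ ⊕ δ) → ℂ) = 0 := by
      intro w d
      set q : Polynomial ℂ := ∑ d : Fin (t + 1), Polynomial.monomial (d : ℕ)
        (∑ k : Fin (n d), a ⟨d, k⟩ * thetaEval L κM (P d k) (w : β ⊕ (γ ⊕ δ) → ℂ)) with hq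
      have hqeval : ∀ c : ℂ, q.eval c = 0 := by
        intro c
        rw [hq, Polynomial.eval_finsetSum, ← hcw w c]
        refine Finset.sum_congr rfl fun d _ => ?_
        rw [Polynomial.eval_monomial]; ring
      have hq0 : q = 0 := Polynomial.funext fun c => by rw [hqeval c, Polynomial.eval_zero]
      have hc : q.coeff d = 0 := by rw [hq0, Polynomial.coeff_zero]
      rw [hq, Polynomial.finsetSum_coeff, Finset.sum_eq_single d] at hc
      · simpa [Polynomial.coeff_monomial] using hc
      · intro d' _ hd'
        rw [Polynomial.coeff_monomial, if_neg]
        exact fun h => hd' (Fin.ext h)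
      · intro h; exact absurd (Finset.mem_univ d) h
    rintro ⟨d, k⟩
    refine Fintype.linearIndependent_iff.mp (hli d) (fun k => a ⟨d, k⟩) ?_ k
    funext w
    simp only [Finset.sum_apply, Pi.smul_apply, smul_eq_mul, zero_add, Pi.zero_apply]
    exact hcoef w d
  have hli' : LinearIndependent ℂ fun i : (Σ d : Fin (t + 1), Fin (n d)) =>
      (⟨Ψ (f i), LinearMap.mem_range_self Ψ (f i)⟩ : LinearMap.range Ψ) :=
    LinearIndependent.of_comp (LinearMap.range Ψ).subtype hliΨ
  have hcard := hli'.fintype_card_le_finrank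
  rw [Fintype.card_sigma] at hcard
  simp only [Fintype.card_fin] at hcard
  have hsum : ∑ d : Fin (t + 1), n d = (t + m + 1).choose (m + 1) := by
    rw [Finset.sum_congr rfl fun d _ => hn d]
    exact sum_fin_add_choose t m
  rw [hsum] at hcard
  exact hcard

/-- **`coneDim (Lie G') ≥ dim G' + 1`** in any theta model. [folklore] -/
theorem finrank_tangent_succ_le_coneDim (K : SubgroupDataC β γ δ κM) :
    finrank ℂ K.tangent + 1 ≤ M.coneDim (K.tangent : Set (β ⊕ (γ ⊕ δ) → ℂ)) := by
  haveI := M.isPrime_vanishing_submodule K.tangent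
  set d := M.coneDim (K.tangent : Set (β ⊕ (γ ⊕ δ) → ℂ)) with hd
  have hdim : ringKrullDim (MvPolynomial (Fin (N + 1)) ℂ ⧸ M.vanishing (K.tangent : Set (β ⊕ (γ ⊕ δ) → ℂ))) = d :=
    (M.coneDim_eq ⟨0, K.tangent.zero_mem⟩).symm
  obtain ⟨ρ, a, γ', -, hs⟩ := ZeroEst.exists_sandwich_of_isPrime
    (𝔭 := M.vanishing (K.tangent : Set (β ⊕ (γ ⊕ δ) → ℂ))) hdim
  refine AnalyticGroupModel.exponent_le_of_choose_le (ρ₁ := 1) (a₁ := 0) (K := 1) (ρ₂ := ρ) (c := 1)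
    (γ₂ := γ') (t₀ := a) le_rfl fun t ht => ?_
  rw [one_mul, one_mul, one_mul, Nat.sub_zero]
  calc (t + (finrank ℂ K.tangent + 1)).choose (finrank ℂ K.tangent + 1)
      = (t + finrank ℂ K.tangent + 1).choose (finrank ℂ K.tangent + 1) := by rw [add_assoc]
    _ ≤ ZeroEst.hilbC ((M.vanishing (K.tangent : Set (β ⊕ (γ ⊕ δ) → ℂ))).restrictScalars ℂ) t :=
        choose_le_hilbC_vanishing_tangent L κM M e hΘ K t
    _ ≤ ρ * (t + γ' + d).choose d := (hs t ht).2


/-! ### The classification -/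

/-- **Classification of the `Θ`-closed irreducible subgroups of `Lie M_κ,ℂ` (at most one elliptic
factor, complex multiplication allowed).** In a theta model of `M_κ`, a closed irreducible additive
subgroup `H₀ ⊆ V` (an obstruction subgroup of `AnalyticGroupModel.zero_estimate`) is
`exp⁻¹(G')` for the connected algebraic subgroup `G'` with datum `hullData (𝒯(H₀))`:
`H₀ = Lie G' + ker(exp_{M_κ})`. [cite: NesterenkoPhilippon2001, Ch. 11 Thm. 4.1 (H₀ = T_e⁻¹(H))] -/
theorem coe_eq_preimageSubgroup_hull (hγ : Fintype.card γ ≤ 1) {H : AddSubgroup (β ⊕ (γ ⊕ δ) → ℂ)}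
    (hH : M.IsIrred (H : Set (β ⊕ (γ ⊕ δ) → ℂ))) :
    (H : Set (β ⊕ (γ ⊕ δ) → ℂ)) =
      (preimageSubgroup L κM (hullData κM (AnalyticGroupModel.linSpace (H : Set (β ⊕ (γ ⊕ δ) → ℂ)))) :
        Set (β ⊕ (γ ⊕ δ) → ℂ)) := by
  set 𝔥 := AnalyticGroupModel.linSpace (H : Set (β ⊕ (γ ⊕ δ) → ℂ)) with h𝔥
  have hcl := hH.isClosedG
  have hT : (hullData κM 𝔥).tangent = 𝔥 := tangent_hull_linSpace_eq L κM M e hΘ hγ hcl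
  -- the closure `Y = Z(𝔍(𝔥))` of the lineality space is all of `H`
  set Y := M.zeroSet ((M.vanishing (𝔥 : Set (β ⊕ (γ ⊕ δ) → ℂ)) : Ideal _) :
    Set (MvPolynomial (Fin (N + 1)) ℂ)) with hY
  have hYcl : M.IsClosedG Y := M.isClosedG_zeroSet _
  have h0Y : (0 : β ⊕ (γ ⊕ δ) → ℂ) ∈ Y := M.subset_zeroSet_vanishing _ 𝔥.zero_mem
  have hYH : Y ⊆ H := by
    rw [← hcl.eq]
    exact M.zeroSet_antitone (M.vanishing_antitone (AnalyticGroupModel.linSpace_subset H))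
  have hdim𝔥 : finrank ℂ 𝔥 + 1 ≤ M.coneDim Y := by
    rw [hY, M.coneDim_zeroSet_vanishing]
    have := finrank_tangent_succ_le_coneDim L κM M e hΘ (hullData κM 𝔥)
    rwa [hT] at this
  have hdimH : M.coneDim (H : Set (β ⊕ (γ ⊕ δ) → ℂ)) ≤ finrank ℂ 𝔥 + 1 :=
    M.coneDim_le_finrank_linSpace_succ H hH
  have hYeq : Y = H := hH.eq_of_subset_of_coneDim_eq M hYcl ⟨0, h0Y⟩ hYH (hdimH.trans hdim𝔥)
  refine Set.Subset.antisymm (fun w hw => ?_) fun w hw => preimageSubgroup_hull_le L κM M e hΘ hγ hcl hw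
  rw [← hYeq] at hw
  exact mem_preimageSubgroup_hull_of_forall_thetaEval L κM hγ 𝔥 fun D P hP hvan =>
    thetaEval_eq_zero_of_mem_zeroSet L κM M e hΘ hP hvan hw

/-- **`dim G' ≤ dim H₀`**: `dim Lie(hull 𝒯(H₀)) + 1 ≤ coneDim H₀`. [folklore] -/
theorem finrank_hull_tangent_succ_le_coneDim (hγ : Fintype.card γ ≤ 1) {H : AddSubgroup (β ⊕ (γ ⊕ δ) → ℂ)}
    (hH : M.IsClosedG (H : Set (β ⊕ (γ ⊕ δ) → ℂ))) :
    finrank ℂ (hullData κM (AnalyticGroupModel.linSpace (H : Set (β ⊕ (γ ⊕ δ) → ℂ)))).tangent + 1 ≤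
      M.coneDim (H : Set (β ⊕ (γ ⊕ δ) → ℂ)) :=
  (finrank_tangent_succ_le_coneDim L κM M e hΘ _).trans
    (M.coneDim_mono (hull_tangent_subset L κM M e hΘ hγ hH))

/-! ### Philippon's zero estimate on `M_κ` with at most one elliptic factor, for a theta model -/

/-- **Philippon's zero estimate (1986, Thm. 2.1) for the theta model of `M_κ` with AT MOST ONE
elliptic factor, complex multiplication allowed** — the body of the named fact `philippon1986_std`
at `(L, β, γ, δ, κ)` without its `¬ L.HasCM` binder, for `|γ| ≤ 1`, given an analytic group model
`M` whose coordinates are the theta functions (`hΘ`): Roy's zero estimate for `M`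
(`AnalyticGroupModel.zero_estimate`) with `Σ = {0, v, …, Sv}`, the classification of the
obstruction subgroup (`coe_eq_preimageSubgroup_hull`: `H₀ = Lie G' + ker`, `Lie G' = 𝒯(H₀)`), the
count `card{σ + H₀} = orbitCard` and the exponent `dim G' ≤ coneDim H₀ - 1`; constant
`c = c₀(M) + 1`. [cite: Philippon1986, Thm 2.1] [cite: NesterenkoPhilippon2001, Ch. 11 Thm. 4.1] -/
theorem zeroEstimate_of_thetaModel (hγ : Fintype.card γ ≤ 1) :
    ∃ c : ℝ, 0 < c ∧ ∀ (𝔟 : Submodule ℂ (β ⊕ (γ ⊕ δ) → ℂ)) (v : β ⊕ (γ ⊕ δ) → ℂ)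
        (P : MvPolynomial (Option β × ThetaIdx γ δ) ℂ) (D S T : ℕ),
        0 < finrank ℂ 𝔟 → 1 ≤ D → 1 ≤ S → P.IsHomogeneous D →
        (∃ w, thetaEval L κM P w ≠ 0) →
        (∀ s : ℕ, s ≤ Fintype.card (β ⊕ (γ ⊕ δ)) * S →
          VanishesAlong 𝔟 (thetaEval L κM P) ((s : ℂ) • v) (Fintype.card (β ⊕ (γ ⊕ δ)) * T + 1)) →
        ∃ K : SubgroupDataC β γ δ κM,
          (∃ w₀, ∀ w ∈ K.tangent, thetaEval L κM P (w₀ + w) = 0) ∧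
          (Nat.choose (T + (finrank ℂ 𝔟 - finrank ℂ ↥(𝔟 ⊓ K.tangent)))
              (finrank ℂ 𝔟 - finrank ℂ ↥(𝔟 ⊓ K.tangent)) : ℝ) *
            (orbitCard L κM K v S : ℝ) * (D : ℝ) ^ finrank ℂ K.tangent ≤
            c * (D : ℝ) ^ Fintype.card (β ⊕ (γ ⊕ δ)) := by
  classical
  refine ⟨(M.mainConst : ℝ) + 1, by positivity, ?_⟩
  intro 𝔟 v P D S T _ hD _ hP hP0 hvan
  have hn : M.dim = Fintype.card (β ⊕ (γ ⊕ δ)) := by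
    rw [← M.finrank_eq, Module.finrank_fintype_fun_eq_card]
  -- the data of Roy's theorem
  have hP' : (rename e P).IsHomogeneous D := hP.rename_isHomogeneous
  have hFP : M.F (rename e P) = thetaEval L κM P := funext fun w => F_rename L κM M e hΘ P w
  have hP0' : ∃ w, M.F (rename e P) w ≠ 0 := by rw [hFP]; exact hP0
  have hvan' : ∀ σ ∈ AnalyticGroupModel.sumset (AnalyticGroupModel.multiples v S) M.dim,
      AnalyticGroupModel.VanishesToOrder 𝔟 (M.F (rename e P)) σ (M.dim * T + 1) := by
    intro σ hσ
    rw [AnalyticGroupModel.sumset_multiples, AnalyticGroupModel.mem_multiples_iff] at hσ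
    obtain ⟨s, hs, rfl⟩ := hσ
    rw [hFP, hn]
    exact (AnalyticGroupModel.vanishesAlong_iff_vanishesToOrder 𝔟 _ _ _).mp (hvan s (by rw [← hn]; exact hs))
  obtain ⟨H₀, -, hirr, ⟨v₀, hv₀⟩, hineq⟩ := M.zero_estimate 𝔟 (AnalyticGroupModel.multiples_finite v S)
    (AnalyticGroupModel.zero_mem_multiples v S) hP' hP0' hvan'
  -- the classification of the obstruction subgroup
  have hcl := hirr.isClosedG
  set K := hullData κM (AnalyticGroupModel.linSpace ((H₀ : AddSubgroup (β ⊕ (γ ⊕ δ) → ℂ)) :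
    Set (β ⊕ (γ ⊕ δ) → ℂ))) with hK
  have hHK := coe_eq_preimageSubgroup_hull L κM M e hΘ hγ hirr
  have hT := tangent_hull_linSpace_eq L κM M e hΘ hγ hcl
  have hexp := finrank_hull_tangent_succ_le_coneDim L κM M e hΘ hγ hcl
  rw [← hK] at hHK hT hexp
  refine ⟨K, ⟨v₀, fun w hw => ?_⟩, ?_⟩
  · have := hv₀ w (hull_tangent_subset L κM M e hΘ hγ hcl hw)
    rwa [F_rename L κM M e hΘ] at this
  -- the count
  have hcount : ((fun σ => σ +ᵥ ((H₀ : AddSubgroup (β ⊕ (γ ⊕ δ) → ℂ)) : Set (β ⊕ (γ ⊕ δ) → ℂ))) ''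
      AnalyticGroupModel.multiples v S).ncard = orbitCard L κM K v S := by
    rw [hHK]
    exact AnalyticGroupModel.ncard_image_vadd_multiples_eq_orbitCard L κM K v S
  rw [← hT, hcount, hn] at hineq
  set s := finrank ℂ 𝔟 - finrank ℂ ↥(𝔟 ⊓ K.tangent) with hs
  have hpow : D ^ finrank ℂ K.tangent ≤ D ^ (M.coneDim ((H₀ : AddSubgroup (β ⊕ (γ ⊕ δ) → ℂ)) :
      Set (β ⊕ (γ ⊕ δ) → ℂ)) - 1) := Nat.pow_le_pow_right hD (by omega)
  have hnat : (T + s).choose s * orbitCard L κM K v S * D ^ finrank ℂ K.tangent ≤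
      (M.mainConst + 1) * D ^ Fintype.card (β ⊕ (γ ⊕ δ)) :=
    calc (T + s).choose s * orbitCard L κM K v S * D ^ finrank ℂ K.tangent
        ≤ (T + s).choose s * orbitCard L κM K v S *
            D ^ (M.coneDim ((H₀ : AddSubgroup (β ⊕ (γ ⊕ δ) → ℂ)) : Set (β ⊕ (γ ⊕ δ) → ℂ)) - 1) :=
          Nat.mul_le_mul_left _ hpow
      _ ≤ M.mainConst * D ^ Fintype.card (β ⊕ (γ ⊕ δ)) := hineq
      _ ≤ (M.mainConst + 1) * D ^ Fintype.card (β ⊕ (γ ⊕ δ)) := Nat.mul_le_mul_right _ (Nat.le_succ _)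
  exact_mod_cast hnat

end Model

/-! ### The theta model of `PkappaAnalyticGroupModel.lean`: the zero estimate from the hard data -/

/-- The coordinates of the theta model are the theta functions (up to the indexing
`idxEquiv`). [folklore] -/
theorem Θ_thetaModel_symm (H : HardData (β := β) L κM) (J : Option β × ThetaIdx γ δ)
    (w : β ⊕ (γ ⊕ δ) → ℂ) : (thetaModel L κM H).Θ ((idxEquiv β γ δ).symm J) w = theta L κM J w := by
  show Θf L κM ((idxEquiv β γ δ).symm J) w = theta L κM J w
  rw [Θf, Equiv.apply_symm_apply]

/-- **Classification of the closed irreducible subgroups of `Lie M_κ,ℂ` in the theta model, at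
most one elliptic factor, complex multiplication allowed** — the hypothesis `hCL` of
`philippon_shape_of_classification`: `H₀ = exp⁻¹(H_K)`, `𝒯(H₀) = Lie H_K`,
`dim Lie H_K + 1 ≤ coneDim H₀`, with `K = hullData (𝒯(H₀))`. [cite: NesterenkoPhilippon2001, Ch. 11 Thm. 4.1] -/
theorem classification_oneFactor_of_hardData (H : HardData (β := β) L κM) (hγ : Fintype.card γ ≤ 1)
    (H₀ : AddSubgroup (β ⊕ (γ ⊕ δ) → ℂ)) (hirr : (thetaModel L κM H).IsIrred (H₀ : Set (β ⊕ (γ ⊕ δ) → ℂ))) :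
    ∃ K : SubgroupDataC β γ δ κM, (preimageSubgroup L κM K : Set (β ⊕ (γ ⊕ δ) → ℂ)) = H₀ ∧
      AnalyticGroupModel.linSpace ((H₀ : AddSubgroup _) : Set (β ⊕ (γ ⊕ δ) → ℂ)) = K.tangent ∧
      finrank ℂ K.tangent + 1 ≤ (thetaModel L κM H).coneDim ((H₀ : AddSubgroup _) : Set (β ⊕ (γ ⊕ δ) → ℂ)) :=
  ⟨hullData κM (AnalyticGroupModel.linSpace ((H₀ : AddSubgroup _) : Set (β ⊕ (γ ⊕ δ) → ℂ))),
    (coe_eq_preimageSubgroup_hull L κM (thetaModel L κM H) (idxEquiv β γ δ).symm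
      (Θ_thetaModel_symm L κM H) hγ hirr).symm,
    (tangent_hull_linSpace_eq L κM (thetaModel L κM H) (idxEquiv β γ δ).symm
      (Θ_thetaModel_symm L κM H) hγ hirr.isClosedG).symm,
    finrank_hull_tangent_succ_le_coneDim L κM (thetaModel L κM H) (idxEquiv β γ δ).symm
      (Θ_thetaModel_symm L κM H) hγ hirr.isClosedG⟩

/-- **Philippon's zero estimate (1986, Thm. 2.1) on `M_κ = 𝔾ₘ^β × P_κ` with at most one elliptic
factor, complex multiplication allowed, from the hard data of the theta embedding**: the body of
the named fact `philippon1986_std` at `(L, β, γ, δ, κ)` without its `¬ L.HasCM` binder, for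
`|γ| ≤ 1` — the hypothesis `hZ` of `ellipticPeriod_not_mem_logSpan_of_zeroEstimate_oneFactor`
at `L`. [cite: Philippon1986, Thm 2.1] [cite: NesterenkoPhilippon2001, Ch. 11 Thm. 4.1] -/
theorem zeroEstimate_oneFactor_of_hardData (H : HardData (β := β) L κM) (hγ : Fintype.card γ ≤ 1) :
    ∃ c : ℝ, 0 < c ∧ ∀ (𝔟 : Submodule ℂ (β ⊕ (γ ⊕ δ) → ℂ)) (v : β ⊕ (γ ⊕ δ) → ℂ)
        (P : MvPolynomial (Option β × ThetaIdx γ δ) ℂ) (D S T : ℕ),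
        0 < finrank ℂ 𝔟 → 1 ≤ D → 1 ≤ S → P.IsHomogeneous D →
        (∃ w, thetaEval L κM P w ≠ 0) →
        (∀ s : ℕ, s ≤ Fintype.card (β ⊕ (γ ⊕ δ)) * S →
          VanishesAlong 𝔟 (thetaEval L κM P) ((s : ℂ) • v) (Fintype.card (β ⊕ (γ ⊕ δ)) * T + 1)) →
        ∃ K : SubgroupDataC β γ δ κM,
          (∃ w₀, ∀ w ∈ K.tangent, thetaEval L κM P (w₀ + w) = 0) ∧
          (Nat.choose (T + (finrank ℂ 𝔟 - finrank ℂ ↥(𝔟 ⊓ K.tangent)))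
              (finrank ℂ 𝔟 - finrank ℂ ↥(𝔟 ⊓ K.tangent)) : ℝ) *
            (orbitCard L κM K v S : ℝ) * (D : ℝ) ^ finrank ℂ K.tangent ≤
            c * (D : ℝ) ^ Fintype.card (β ⊕ (γ ⊕ δ)) :=
  zeroEstimate_of_thetaModel L κM (thetaModel L κM H) (idxEquiv β γ δ).symm (Θ_thetaModel_symm L κM H) hγ

end Std

end GaGmE

end Literature.NumberTheory.Transcendental

end
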